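import Mathlib
import HarnessLib

/-!
# CAP window checker (cell pub-adcap) — kernel-checkable versions of conditions ii and iii of the interval-shadowing theorem

CITATION HEADER (lean-in-tree rule, cell pub-adcap, 2026-08-18). This module gives DECIDABLE (Boolean, kernel-evaluable by
`decide`) checks of the two purely combinatorial hypotheses of the interval-shadowing theorem of Capiński–Gidea,
CPAM 76 (2023) Theorem 4.2 [cite: CapinskiGidea2021, Thm 4.2] as restated in arXiv:2504.09273 Theorem 19 (p. 26):

  ii.  the projections of the initial windows `N_{ℓ,0}` onto the centre coordinates `(I, α)` cover the centre part of the strip;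
  iii. whenever `N_{ℓ,0} ∩ N_{ℓ',0} ≠ ∅`, for EVERY point `(I*, α*)` of the intersection the rectangle
       `([I* − a_I, I* + a_I] ∩ [0,1]) × ([α* − a_α, α* + a_α] ∩ S_α)` is contained in `N_{ℓ,0}` or in `N_{ℓ',0}`

(quoted from arXiv:2504.09273 p0026 L36–L45; the theorem's `[0,1]` is any closed action interval after rescaling; the strip's
`u, s` factors are common to all windows by Definition 17.3, so only the CENTRE projections enter here), together with the
containment `π N_{ℓ,0} ⊆ π S` of Definition 17.3. Each check comes with a SOUNDNESS theorem: `check = true` implies the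
set-theoretic condition, quantified over ALL rational points (not over corners or grid midpoints). The data are closed boxes
in `ℚ^n` (`n = 2` for the template; the checks are written for any `n`), so a certificate's `windows.json` becomes a `def`
of type `WindowData n` and the two conditions are discharged by `decide` (kernel) — REFEREE.md item D2.

Why quantify over every point (audit note, seat 3, 2026-08-18T19:20Z): a check of condition iii at the CORNERS of each
intersection only is NOT sound — with `a = 1/5`, `W₁ = [0,1] × [−1, 3/5]`, `W₂ = [0,1] × [2/5, 2]`, strip `[0,1] × [−1, 2]`,
all four corners of the intersection `[0,1] × [2/5, 3/5]` pass while `(1/2, 1/2)` fails (its rectangle reaches `α = 7/10 > 3/5`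
and `α = 3/10 < 2/5`). `condIII_corner_counterexample` below records this in Lean. The checker here instead computes, per pair,
the exact sub-box of the intersection whose points have their rectangle inside `W₁` (resp. `W₂`) and verifies that these two
sub-boxes cover the intersection by recursive splitting at breakpoints (`coverB`).

Cost (measured on the farm, 2026-08-18): `checkAll` by `decide +kernel` (`Rat` literals need the kernel's GMP `Nat.gcd`, so plain
`decide` gets stuck) takes 3 s for 2 windows, 8 s for 40 and 53 s for 120 chained windows in `ℚ²` — quadratic in the number of
initial windows through `checkIII`; certificates with more than a few hundred initial windows should be checked in slices
(`WindowData` per slice, sharing the strip) or with a sorted variant of `checkIII`. Nothing here is about a specific system: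
no numbers, no vector field. The concrete `WindowData` of a certificate lands in
the certificate's own file. [cite: CapinskiGidea2021, Thm 4.2]
-/

namespace Literature.Dynamics.Hamiltonian.ArnoldDiffusionCAP.Windows

/-- A closed coordinate box in `ℚ^n`: coordinate `i` ranges over `[(B i).1, (B i).2]`. Empty if some `(B i).2 < (B i).1`.
[folklore] -/
abbrev Box (n : ℕ) := Fin n → ℚ × ℚ

/-- A point of `ℚ^n`. [folklore] -/
abbrev Pt (n : ℕ) := Fin n → ℚ

/-- `p ∈ B` (closed box membership). [folklore] -/
def Mem {n : ℕ} (p : Pt n) (B : Box n) : Prop := ∀ i, (B i).1 ≤ p i ∧ p i ≤ (B i).2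

/-- Box membership is decidable (finite conjunction of `ℚ` comparisons). [folklore] -/
instance {n : ℕ} (p : Pt n) (B : Box n) : Decidable (Mem p B) := by unfold Mem; infer_instance

/-- Boolean: `A ⊆ B` as boxes, in the STRONG sense `∀ i, (B i).1 ≤ (A i).1 ∧ (A i).2 ≤ (B i).2` (sufficient for set
containment; also necessary when `A` is non-empty). [folklore] -/
def subsetB {n : ℕ} (A B : Box n) : Bool :=
  (List.finRange n).all fun i => decide ((B i).1 ≤ (A i).1 ∧ (A i).2 ≤ (B i).2)

/-- Boolean: the box is empty in some coordinate. [folklore] -/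
def emptyB {n : ℕ} (A : Box n) : Bool :=
  (List.finRange n).any fun i => decide ((A i).2 < (A i).1)

/-- Soundness of `subsetB`: a point of `A` is a point of `B`. [folklore] -/
theorem subsetB_sound {n : ℕ} {A B : Box n} (h : subsetB A B = true) {p : Pt n} (hp : Mem p A) : Mem p B := by
  intro i
  have hi := (List.all_eq_true.1 h) i (List.mem_finRange i)
  simp only [decide_eq_true_eq] at hi
  exact ⟨le_trans hi.1 (hp i).1, le_trans (hp i).2 hi.2⟩

/-- Soundness of `emptyB`: an empty box has no points. [folklore] -/
theorem emptyB_sound {n : ℕ} {A : Box n} (h : emptyB A = true) (p : Pt n) : ¬ Mem p A := by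
  intro hp
  obtain ⟨i, -, hi⟩ := List.any_eq_true.1 h
  simp only [decide_eq_true_eq] at hi
  exact absurd (le_trans (hp i).1 (hp i).2) (not_le.2 hi)

/-- The lower half of `A` cut at value `b` in coordinate `i`. [folklore] -/
def splitLo {n : ℕ} (A : Box n) (i : Fin n) (b : ℚ) : Box n := Function.update A i ((A i).1, b)
/-- The upper half of `A` cut at value `b` in coordinate `i`. [folklore] -/
def splitHi {n : ℕ} (A : Box n) (i : Fin n) (b : ℚ) : Box n := Function.update A i (b, (A i).2)

/-- A point of `A` lies in one of the two halves. [folklore] -/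
theorem mem_split {n : ℕ} {A : Box n} {i : Fin n} {b : ℚ} {p : Pt n} (hp : Mem p A) :
    Mem p (splitLo A i b) ∨ Mem p (splitHi A i b) := by
  rcases le_total (p i) b with h | h
  · left; intro j
    by_cases hj : j = i
    · subst hj; simp only [splitLo, Function.update_self]; exact ⟨(hp j).1, h⟩
    · simp only [splitLo, Function.update_of_ne hj]; exact hp j
  · right; intro j
    by_cases hj : j = i
    · subst hj; simp only [splitHi, Function.update_self]; exact ⟨h, (hp j).2⟩
    · simp only [splitHi, Function.update_of_ne hj]; exact hp j

/-- The first breakpoint of some window in `ws` lying STRICTLY inside `A` in some coordinate, if any. [folklore] -/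
def findBreak {n : ℕ} (A : Box n) (ws : List (Box n)) : Option (Fin n × ℚ) :=
  ws.findSome? fun w => (List.finRange n).findSome? fun i =>
    if (A i).1 < (w i).1 ∧ (w i).1 < (A i).2 then some (i, (w i).1)
    else if (A i).1 < (w i).2 ∧ (w i).2 < (A i).2 then some (i, (w i).2)
    else none

/-- Boolean cover check: `A ⊆ ⋃ ws`, by recursive splitting of `A` at breakpoints of the windows (fuel-bounded; running out of
fuel answers `false`, so soundness never depends on the fuel). Complete for `fuel ≥ 2 · n · ws.length + 1`. [folklore] -/
def coverB {n : ℕ} (ws : List (Box n)) : ℕ → Box n → Bool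
  | 0, A => emptyB A || ws.any (fun w => subsetB A w)
  | fuel + 1, A =>
    emptyB A || ws.any (fun w => subsetB A w) ||
      match findBreak A ws with
      | none => false
      | some (i, b) => coverB ws fuel (splitLo A i b) && coverB ws fuel (splitHi A i b)

/-- Soundness of `coverB`, by induction on the fuel: `true` means every point of `A` lies in some window. [folklore] -/
theorem coverB_sound {n : ℕ} (ws : List (Box n)) :
    ∀ (fuel : ℕ) (A : Box n), coverB ws fuel A = true → ∀ p : Pt n, Mem p A → ∃ w ∈ ws, Mem p w := by
  intro fuel
  induction fuel with
  | zero =>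
    intro A h p hp
    simp only [coverB, Bool.or_eq_true] at h
    rcases h with h | h
    · exact absurd hp (emptyB_sound h p)
    · obtain ⟨w, hw, hsub⟩ := List.any_eq_true.1 h
      exact ⟨w, hw, subsetB_sound hsub hp⟩
  | succ fuel ih =>
    intro A h p hp
    simp only [coverB, Bool.or_eq_true] at h
    rcases h with (h | h) | h
    · exact absurd hp (emptyB_sound h p)
    · obtain ⟨w, hw, hsub⟩ := List.any_eq_true.1 h
      exact ⟨w, hw, subsetB_sound hsub hp⟩
    · revert h
      cases findBreak A ws with
      | none => simp
      | some ib =>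
        obtain ⟨i, b⟩ := ib
        simp only [Bool.and_eq_true]
        intro h
        rcases mem_split (A := A) (i := i) (b := b) hp with hlo | hhi
        · exact ih _ h.1 p hlo
        · exact ih _ h.2 p hhi

/-- Coordinatewise intersection of two boxes (a box; empty if they are disjoint). [folklore] -/
def inter {n : ℕ} (A B : Box n) : Box n := fun i => (max (A i).1 (B i).1, min (A i).2 (B i).2)

/-- A common point of two boxes lies in their intersection box. [folklore] -/
theorem mem_inter {n : ℕ} {A B : Box n} {p : Pt n} (hA : Mem p A) (hB : Mem p B) : Mem p (inter A B) := fun i =>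
  ⟨max_le (hA i).1 (hB i).1, le_min (hA i).2 (hB i).2⟩

/-- The `a`-rectangle of condition iii around `p`, clipped to the strip `S`:
`{q | ∀ i, max (p i − a i) (S i).1 ≤ q i ≤ min (p i + a i) (S i).2}`. [cite: CapinskiGidea2021, Thm 4.2 (iii)] -/
def rect {n : ℕ} (S : Box n) (a : Pt n) (p : Pt n) : Box n :=
  fun i => (max (p i - a i) (S i).1, min (p i + a i) (S i).2)

/-- The sub-box of `R` (intended: `R = inter W₁ W₂`) consisting of the points `p` whose clipped rectangle `rect S a p` lies
inside `W`; only the direction "`p ∈ shrink` ⇒ `rect S a p ⊆ W`" is used (`shrink_sound`). [folklore] -/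
def shrink {n : ℕ} (S : Box n) (a : Pt n) (R W : Box n) : Box n := fun i =>
  ((if (W i).1 ≤ (S i).1 then (R i).1 else max (R i).1 ((W i).1 + a i)),
   (if (S i).2 ≤ (W i).2 then (R i).2 else min (R i).2 ((W i).2 - a i)))

/-- Soundness of `shrink`: a point of the shrunk box has its whole clipped `a`-rectangle inside `W`. [folklore] -/
theorem shrink_sound {n : ℕ} {S : Box n} {a : Pt n} {R W : Box n} {p : Pt n} (hp : Mem p (shrink S a R W))
    {q : Pt n} (hq : Mem q (rect S a p)) : Mem q W := by
  intro i
  have h1 := (hp i).1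
  have h2 := (hp i).2
  have hq1 := (hq i).1
  have hq2 := (hq i).2
  simp only [shrink] at h1 h2
  simp only [rect] at hq1 hq2
  constructor
  · split_ifs at h1 with hw
    · exact le_trans hw (le_trans (le_max_right _ _) hq1)
    · have : (W i).1 + a i ≤ p i := le_trans (le_max_right _ _) h1
      have := le_trans (le_max_left _ _) hq1
      linarith
  · split_ifs at h2 with hw
    · exact le_trans (le_trans hq2 (min_le_right _ _)) hw
    · have : p i ≤ (W i).2 - a i := le_trans h2 (min_le_right _ _)
      have := le_trans hq2 (min_le_left _ _)
      linarith

/-- The finite window data of a certificate: the centre projection of the strip `S`, the cone radii `a` (`a_I`, `a_α`, …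
of the cone (50) of arXiv:2504.09273), and the centre projections of the initial windows `N_{ℓ,0}`.
[cite: CapinskiGidea2021, Thm 4.2] -/
structure WindowData (n : ℕ) where
  strip : Box n
  radii : Pt n
  windows : List (Box n)

/-- Condition ii of [cite: CapinskiGidea2021, Thm 4.2]: the initial windows cover the centre part of the strip. -/
def CondII {n : ℕ} (d : WindowData n) : Prop :=
  ∀ p : Pt n, Mem p d.strip → ∃ w ∈ d.windows, Mem p w

/-- Definition 17.3 of arXiv:2504.09273 (`N_{ℓ,0} ⊂ S`), centre part: every initial window lies in the strip.
[cite: CapinskiGidea2021, Def. 4.1] -/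
def Inside {n : ℕ} (d : WindowData n) : Prop :=
  ∀ w ∈ d.windows, ∀ p : Pt n, Mem p w → Mem p d.strip

/-- Condition iii of [cite: CapinskiGidea2021, Thm 4.2], for EVERY point of every pairwise intersection of DISTINCT initial
windows (indices `i ≠ j`): the clipped `a`-rectangle around the point lies in one of the two windows. -/
def CondIII {n : ℕ} (d : WindowData n) : Prop :=
  ∀ (i j : Fin d.windows.length), i ≠ j →
    ∀ p : Pt n, Mem p d.windows[i] → Mem p d.windows[j] →
      (∀ q : Pt n, Mem q (rect d.strip d.radii p) → Mem q d.windows[i]) ∨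
      (∀ q : Pt n, Mem q (rect d.strip d.radii p) → Mem q d.windows[j])

/-- Default fuel for `coverB` (complete: at most `2 n · #ws` distinct breakpoints can lie strictly inside a box). [folklore] -/
def fuelFor {n : ℕ} (ws : List (Box n)) : ℕ := 2 * n * ws.length + 1

/-- Boolean check of condition ii. [cite: CapinskiGidea2021, Thm 4.2 (ii)] -/
def checkII {n : ℕ} (d : WindowData n) : Bool := coverB d.windows (fuelFor d.windows) d.strip

/-- Boolean check of the containment `N_{ℓ,0} ⊆ S` (empty windows pass vacuously). [cite: CapinskiGidea2021, Def. 4.1] -/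
def checkInside {n : ℕ} (d : WindowData n) : Bool :=
  d.windows.all fun w => emptyB w || subsetB w d.strip

/-- Boolean check of condition iii: for each ordered pair `i ≠ j`, the intersection `R` is covered by the two shrunk boxes
`shrink S a R Wᵢ`, `shrink S a R Wⱼ` (checked with `coverB`; an empty `R` passes at once). [cite: CapinskiGidea2021, Thm 4.2 (iii)] -/
def checkIII {n : ℕ} (d : WindowData n) : Bool :=
  let ws := d.windows
  (List.finRange ws.length).all fun i => (List.finRange ws.length).all fun j =>
    decide (i = j) ||
      (let R := inter ws[i] ws[j]
       coverB [shrink d.strip d.radii R ws[i], shrink d.strip d.radii R ws[j]] (fuelFor [ws[i], ws[j]]) R)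

/-- All three checks. [cite: CapinskiGidea2021, Thm 4.2] -/
def checkAll {n : ℕ} (d : WindowData n) : Bool := checkII d && checkInside d && checkIII d

/-- Soundness of `checkII`. [cite: CapinskiGidea2021, Thm 4.2 (ii)] -/
theorem checkII_sound {n : ℕ} {d : WindowData n} (h : checkII d = true) : CondII d :=
  fun p hp => coverB_sound d.windows _ d.strip h p hp

/-- Soundness of `checkInside`. [cite: CapinskiGidea2021, Def. 4.1] -/
theorem checkInside_sound {n : ℕ} {d : WindowData n} (h : checkInside d = true) : Inside d := by
  intro w hw p hp
  have hw' := (List.all_eq_true.1 h) w hw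
  simp only [Bool.or_eq_true] at hw'
  rcases hw' with he | hs
  · exact absurd hp (emptyB_sound he p)
  · exact subsetB_sound hs hp

/-- Soundness of `checkIII`: for every ordered pair of distinct windows and EVERY point of their intersection, the clipped
rectangle lies inside one of the two. [cite: CapinskiGidea2021, Thm 4.2 (iii)] -/
theorem checkIII_sound {n : ℕ} {d : WindowData n} (h : checkIII d = true) : CondIII d := by
  intro i j hij p hpi hpj
  have hi := (List.all_eq_true.1 h) i (List.mem_finRange i)
  have hj := (List.all_eq_true.1 hi) j (List.mem_finRange j)
  simp only [Bool.or_eq_true, decide_eq_true_eq] at hj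
  rcases hj with hj | hj
  · exact absurd hj hij
  · obtain ⟨w, hw, hpw⟩ := coverB_sound _ _ _ hj p (mem_inter hpi hpj)
    simp only [List.mem_cons, List.not_mem_nil, or_false] at hw
    rcases hw with rfl | rfl
    · exact Or.inl fun q hq => shrink_sound hpw hq
    · exact Or.inr fun q hq => shrink_sound hpw hq

/-- Soundness of the bundle: `checkAll d = true` (kernel-checked by `decide` on concrete data) yields conditions ii, iii and the
strip containment as set-theoretic statements over ALL rational points. [cite: CapinskiGidea2021, Thm 4.2] -/
theorem checkAll_sound {n : ℕ} {d : WindowData n} (h : checkAll d = true) : CondII d ∧ Inside d ∧ CondIII d := by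
  simp only [checkAll, Bool.and_eq_true] at h
  exact ⟨checkII_sound h.1.1, checkInside_sound h.1.2, checkIII_sound h.2⟩

/-! ## Self-tests (kernel-evaluated) -/

/-- Two overlapping windows covering `[0,1] × [0,1]` with overlap `1/10 ≥ a = 1/20`: all checks pass. [folklore] -/
def testGood : WindowData 2 :=
  { strip := ![(0, 1), (0, 1)], radii := ![1/20, 1/20],
    windows := [![(0, 3/5), (0, 1)], ![(1/2, 1), (0, 1)]] }

example : checkAll testGood = true := by decide +kernel

/-- Overlap `1/50 < a = 1/20`: condition iii fails at the checker (cover, containment still pass). [folklore] -/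
def testThin : WindowData 2 :=
  { strip := ![(0, 1), (0, 1)], radii := ![1/20, 1/20],
    windows := [![(0, 3/5), (0, 1)], ![(29/50, 1), (0, 1)]] }

example : checkII testThin = true ∧ checkInside testThin = true ∧ checkIII testThin = false := by decide +kernel

/-- A gap in the cover (`[0, 2/5] ∪ [1/2, 1]`): condition ii fails at the checker. [folklore] -/
def testGap : WindowData 2 :=
  { strip := ![(0, 1), (0, 1)], radii := ![1/20, 1/20],
    windows := [![(0, 2/5), (0, 1)], ![(1/2, 1), (0, 1)]] }

example : checkII testGap = false := by decide +kernel

/-- The corner-only counterexample from the header: `W₁ = [0,1] × [−1, 3/5]`, `W₂ = [0,1] × [2/5, 2]`, `a = (1/5, 1/5)`,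
strip `[0,1] × [−1, 2]`. The exact checker REJECTS it (condition iii genuinely fails at `(1/2, 1/2)`), while every corner of the
intersection `[0,1] × [2/5, 3/5]` has its rectangle inside one of the two windows — so a corner-only test would wrongly accept.
[folklore] -/
def testCorner : WindowData 2 :=
  { strip := ![(0, 1), (-1, 2)], radii := ![1/5, 1/5],
    windows := [![(0, 1), (-1, 3/5)], ![(0, 1), (2/5, 2)]] }

example : checkIII testCorner = false := by decide +kernel

/-- The four corners of the intersection each pass the rectangle test … -/
example : ∀ c ∈ ([![0, 2/5], ![1, 2/5], ![0, 3/5], ![1, 3/5]] : List (Pt 2)),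
    subsetB (rect testCorner.strip testCorner.radii c) testCorner.windows[0] = true ∨
    subsetB (rect testCorner.strip testCorner.radii c) testCorner.windows[1] = true := by decide +kernel

/-- … but the interior point `(1/2, 1/2)` of the intersection does not: `CondIII testCorner` is FALSE. [folklore] -/
theorem condIII_corner_counterexample : ¬ CondIII testCorner := by
  intro h
  have h01 : (⟨0, by simp [testCorner]⟩ : Fin testCorner.windows.length) ≠ ⟨1, by simp [testCorner]⟩ := by simp
  have hp0 : Mem (![1/2, 1/2] : Pt 2) testCorner.windows[(⟨0, by simp [testCorner]⟩ : Fin testCorner.windows.length)] := by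
    decide +kernel +revert
  have hp1 : Mem (![1/2, 1/2] : Pt 2) testCorner.windows[(⟨1, by simp [testCorner]⟩ : Fin testCorner.windows.length)] := by
    decide +kernel +revert
  have hq : Mem (![1/2, 7/10] : Pt 2) (rect testCorner.strip testCorner.radii ![1/2, 1/2]) := by decide +kernel +revert
  have hq' : Mem (![1/2, 3/10] : Pt 2) (rect testCorner.strip testCorner.radii ![1/2, 1/2]) := by decide +kernel +revert
  have n0 : ¬ Mem (![1/2, 7/10] : Pt 2) testCorner.windows[(⟨0, by simp [testCorner]⟩ : Fin testCorner.windows.length)] := by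
    decide +kernel +revert
  have n1 : ¬ Mem (![1/2, 3/10] : Pt 2) testCorner.windows[(⟨1, by simp [testCorner]⟩ : Fin testCorner.windows.length)] := by
    decide +kernel +revert
  rcases h _ _ h01 _ hp0 hp1 with h0 | h1
  · exact n0 (h0 _ hq)
  · exact n1 (h1 _ hq')

end Literature.Dynamics.Hamiltonian.ArnoldDiffusionCAP.Windows
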